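import Mathlib
import Summits.NavierStokesRegularity.NavierStokesRegularity.Theorems.FilamentSkeletonRssSkeletonJ1LSymmetricTrueStreamline

/-!
# `TangentSkeletonNearStraightL` (stmt-NavierStokesRegularity-23320) BY NAME — the IRREDUCIBLE form of the ∀-datum heart:
# near-straight EXACT STREAMLINES of the explicit true field with supercritical TRUE-SLIP zeros (everything else derived)

Companion, for the heart itself (all general-position data), of the one-curve form of the parent (`Theorems.SkeletonJ1LSymmetricTrueStreamline`, p838040).
Starting from the curve core (`Theorems.TangentSkeletonLCurveCore.tangentSkeletonNearStraightL_of_curveCore`, p837172: unit cores, `KA = 1`), this file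
also DERIVES: chord–arc, escape and properness (`cg := 7/8`, `Theorems.NearStraightGeometry`, from unit speed + oscillation `≤ Rb ≤ ½` + waists); the `∀ u v`
defining-equation quantifier (`trueField_of_defining`: any admissible `v` is `SkeletonJ1RFrame.trueField Γ γ α X`); the slip-definition clause (slips := TRUE
slips `s_j = ⟪trueField(X)(X_j ·), X_j′⟫`) and their differentiability (`differentiable_trueSlip_of_nearStraight`, via `SkeletonJ1RFrame.trueField_differentiable`
and the linear growth of every strand); `α ≠ 0`, `γ_j ≠ 0` (from the box).
★ `tangentSkeletonNearStraightL_of_trueStreamlines` — ROUTE DECL ⟨23320⟩ BY NAME from: for every `N ≥ 2`, `θd > 0`, `(γ, α)` in the `θd`-box, box constants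
(`2Kρ ≤ 1`, `Λ ≥ 1`, `Rb₁ ≤ ½`, a `θ₀`-box containing `(γ, α)`), and for all `0 < Rb ≤ Rb₁`, all large `Γ`: `N` unit-speed `C²` curves `X_j` with zeros `c_j` such that
curvature `≤ K/√Γ`, tangent oscillation `≤ Rb`, pairwise separation `ρ√Γ`, waists `‖X_j(c_j)‖ ≤ Rw√Γ`, tilts, TRUE slips vanishing only at `c_j` with
`3/2 + δ ≤ s_j′(c_j) ≤ Λ`, `|s_j′| ≤ Λ`, and each `X_j` an EXACT STREAMLINE of `trueField Γ γ α X` on the ball `‖X_j‖ ≤ Rb√(Γ log Γ)`.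
HONEST FRAMING: bookkeeping about a HYPOTHETICAL filament skeleton on the NEGATIVE side of a MODEL route; the existence of such streamlines (the heart) remains
OPEN; no registered stub is closed; nothing bears on Navier–Stokes regularity or blow-up.  `--supports stmt-NavierStokesRegularity-23320`. [folklore]
-/

set_option linter.dupNamespace false

noncomputable section

namespace Summit.NavierStokesRegularity.NavierStokesRegularity.Theorems.TangentSkeletonLTrueStreamlines

open Filter MeasureTheory
open scoped InnerProductSpace BigOperators
open Literature.Analysis.FluidPDE
open Summit.NavierStokesRegularity.NavierStokesRegularity.Theorems.SkeletonJ1RFrame (trueField trueField_differentiable)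
open Summit.NavierStokesRegularity.NavierStokesRegularity.Theorems.TangentSkeletonLCurveCore (tangentSkeletonNearStraightL_of_curveCore)
open Summit.NavierStokesRegularity.NavierStokesRegularity.Theorems.SkeletonJ1LSymmetricStreamline (trueField_of_defining)

/-- **True slips of near-straight `C²` strands with waists are differentiable** (general `N`): `trueField` is differentiable in the evaluation point
(every strand `C¹`, `‖X′‖ ≤ 1`, common linear growth `(7/8)|u| − C ≤ ‖X_k u‖` from the near-straight escape), composed with `X_j ∈ C²`, paired with `X_j′ ∈ C¹`.
[folklore] -/
theorem differentiable_trueSlip_of_nearStraight {N : ℕ} {X : Fin N → ℝ → EuclideanSpace ℝ (Fin 3)} {c : Fin N → ℝ} {Γ Rb Rw α : ℝ}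
    {γ : Fin N → ℝ} (hC : ∀ k, ContDiff ℝ 2 (X k)) (hunit : ∀ k τ, ‖deriv (X k) τ‖ = 1)
    (hosc : ∀ k τ σ, ‖deriv (X k) τ - deriv (X k) σ‖ ≤ Rb) (hRb : Rb ≤ 1 / 2) (hwaist : ∀ k, ‖X k (c k)‖ ≤ Rw * √Γ) (j : Fin N) :
    Differentiable ℝ (fun τ => ⟪trueField Γ γ α X (X j τ), deriv (X j) τ⟫_ℝ) := by
  have hd : ∀ k, Differentiable ℝ (X k) := fun k => (hC k).differentiable (by norm_num)
  have hesc : ∀ k τ, 7 / 8 * |τ - c k| ≤ Rw * √Γ + ‖X k τ‖ :=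
    fun k τ => NearStraightGeometry.escape_of_nearStraight (hd k) (hunit k) (hosc k) hRb (hwaist k) τ
  -- a common growth constant: `C = (7/8) Σ_k |c_k| + Rw√Γ`
  have hgrow : ∀ k u, 7 / 8 * |u| - (7 / 8 * ∑ i, |c i| + Rw * √Γ) ≤ ‖X k u‖ := by
    intro k u
    have h1 := hesc k u
    have h2 : |u| - |c k| ≤ |u - c k| := abs_sub_abs_le_abs_sub u (c k)
    have h3 : |c k| ≤ ∑ i, |c i| := Finset.single_le_sum (f := fun i => |c i|) (fun i _ => abs_nonneg (c i)) (Finset.mem_univ k)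
    linarith
  have hle : ∀ k u, ‖deriv (X k) u‖ ≤ 1 := fun k u => (hunit k u).le
  have htf : Differentiable ℝ (trueField Γ γ α X) :=
    trueField_differentiable (by norm_num : (0:ℝ) < 7 / 8) (fun k => (hC k).of_le (by norm_num)) hle hgrow
  have hdd : Differentiable ℝ (deriv (X j)) := by
    have := (hC j).differentiable_iteratedDeriv 1 (by norm_num)
    rwa [iteratedDeriv_one] at this
  exact (htf.comp (hd j)).inner ℝ hdd

/-- ★ **ROUTE DECL ⟨23320⟩ BY NAME from near-straight exact streamlines of the true field with supercritical true-slip zeros.** [folklore] -/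
theorem tangentSkeletonNearStraightL_of_trueStreamlines
    (hcore : ∀ (N : ℕ) (θd : ℝ) (γ : Fin N → ℝ) (α : ℝ), 2 ≤ N → 0 < θd →
      (θd ≤ |α| ∧ |α| ≤ θd⁻¹ ∧ ∀ j, θd ≤ |γ j| ∧ |γ j| ≤ θd⁻¹) →
      ∃ (δ ρ K Λ Rw θ₀ Rb₁ : ℝ), 0 < δ ∧ 0 < ρ ∧ 0 < Rw ∧ 0 < θ₀ ∧ 0 < Rb₁ ∧ Rb₁ ≤ 1 / 2 ∧ 2 * K * ρ ≤ 1 ∧ 1 ≤ Λ ∧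
        (θ₀ ≤ |α| ∧ |α| ≤ θ₀⁻¹ ∧ ∀ j, θ₀ ≤ |γ j| ∧ |γ j| ≤ θ₀⁻¹) ∧
        ∀ Rb : ℝ, 0 < Rb → Rb ≤ Rb₁ → ∃ Γ₂ : ℝ, ∀ Γ : ℝ, Γ₂ ≤ Γ →
          ∃ (X : Fin N → ℝ → EuclideanSpace ℝ (Fin 3)) (c : Fin N → ℝ),
            (∀ j, ContDiff ℝ 2 (X j) ∧ (∀ τ, ‖deriv (X j) τ‖ = 1) ∧ (∀ τ, ‖iteratedDeriv 2 (X j) τ‖*√Γ ≤ K) ∧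
              (∀ τ σ, ‖deriv (X j) τ - deriv (X j) σ‖ ≤ Rb) ∧ ‖X j (c j)‖ ≤ Rw*√Γ ∧
              |⟪deriv (X j) (c j), EuclideanSpace.single 2 1⟫_ℝ| ≤ 1-θ₀) ∧
            (∀ j k, j ≠ k → ∀ τ σ, ρ*√Γ ≤ ‖X j τ - X k σ‖) ∧
            (∀ j, (⟪trueField Γ γ α X (X j (c j)), deriv (X j) (c j)⟫_ℝ = 0 ∧
              (∀ τ, ⟪trueField Γ γ α X (X j τ), deriv (X j) τ⟫_ℝ = 0 → τ = c j) ∧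
              3/2+δ ≤ deriv (fun τ => ⟪trueField Γ γ α X (X j τ), deriv (X j) τ⟫_ℝ) (c j) ∧
              deriv (fun τ => ⟪trueField Γ γ α X (X j τ), deriv (X j) τ⟫_ℝ) (c j) ≤ Λ) ∧
              (∀ τ, |deriv (fun τ => ⟪trueField Γ γ α X (X j τ), deriv (X j) τ⟫_ℝ) τ| ≤ Λ)) ∧
            (∀ j τ, ‖X j τ‖ ≤ Rb*√(Γ*Real.log Γ) →
              trueField Γ γ α X (X j τ) = ⟪trueField Γ γ α X (X j τ), deriv (X j) τ⟫_ℝ • deriv (X j) τ)) :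
    Summit.NavierStokesRegularity.NavierStokesRegularity.Theses.FilamentSkeletonRss.TangentSkeletonNearStraightL := by
  refine tangentSkeletonNearStraightL_of_curveCore ?_
  intro N θd γ α hN hθ hbox
  obtain ⟨δ, ρ, K, Λ, Rw, θ₀, Rb₁, hδ, hρ, hRw, hθ₀, hRb₁, hRbh, hKρ, hΛ, hbox0, hfam⟩ := hcore N θd γ α hN hθ hbox
  refine ⟨δ, ρ, K, Λ, Rw, 7 / 8, θ₀, Rb₁, hδ, hρ, hRw, by norm_num, hθ₀, hRb₁, hKρ, hΛ, ?_⟩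
  intro Rb hRb hRb1
  obtain ⟨Γ₂, hΓ⟩ := hfam Rb hRb hRb1
  refine ⟨Γ₂, fun Γ hΓ2 => ?_⟩
  obtain ⟨X, c, hreg, hsep, hslip, htan⟩ := hΓ Γ hΓ2
  have hRb2 : Rb ≤ 1 / 2 := hRb1.trans hRbh
  have hC : ∀ k, ContDiff ℝ 2 (X k) := fun k => (hreg k).1
  have hd : ∀ k, Differentiable ℝ (X k) := fun k => (hC k).differentiable (by norm_num)
  have hunit : ∀ k τ, ‖deriv (X k) τ‖ = 1 := fun k => (hreg k).2.1
  have hosc : ∀ k τ σ, ‖deriv (X k) τ - deriv (X k) σ‖ ≤ Rb := fun k => (hreg k).2.2.2.1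
  have hwaist : ∀ k, ‖X k (c k)‖ ≤ Rw * √Γ := fun k => (hreg k).2.2.2.2.1
  have hα : α ≠ 0 := fun h => by have := hbox0.1; rw [h, abs_zero] at this; linarith
  have hγ : ∀ j, γ j ≠ 0 := fun j h => by have := (hbox0.2.2 j).1; rw [h, abs_zero] at this; linarith
  set w : Fin N → ℝ → ℝ := fun j τ => ⟪trueField Γ γ α X (X j τ), deriv (X j) τ⟫_ℝ with hw
  have hwd : ∀ j, Differentiable ℝ (w j) := fun j => differentiable_trueSlip_of_nearStraight hC hunit hosc hRb2 hwaist j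
  refine ⟨X, w, c, ?_, fun j τ σ => hosc j τ σ, fun j τ => (hslip j).2 τ⟩
  intro u v hu hv
  have hvt : ∀ y, v y = trueField Γ γ α X y := fun y => trueField_of_defining hu hv y
  refine ⟨hα, hγ, fun j => ⟨hC j, hwd j, hunit j, (hreg j).2.2.1, ?_⟩, hsep, ?_, ?_, ?_, ?_, fun j => hwaist j, fun j => (hreg j).2.2.2.2.2,
    hbox0, fun j => (hslip j).1⟩
  · exact NearStraightGeometry.tendsto_norm_of_nearStraight (hd j) (hunit j) (hosc j) hRb2
  · intro j τ σ h
    have := NearStraightGeometry.chordArc_of_nearStraight (hd j) (hunit j) (hosc j) hRb2 τ σ h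
    linarith
  · intro j τ
    exact NearStraightGeometry.escape_of_nearStraight (hd j) (hunit j) (hosc j) hRb2 (hwaist j) τ
  · intro j τ
    rw [hvt]
  · intro j τ hball
    rw [hvt]
    exact htan j τ hball

end Summit.NavierStokesRegularity.NavierStokesRegularity.Theorems.TangentSkeletonLTrueStreamlines

end
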